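import Mathlib
import HarnessLib
import Literature.MathematicalPhysics.StatisticalMechanics.TorusPolymerConnectivity

/-!
# The reblocking map `π : 𝓟_k → 𝓟_{k+1}` of Adams–Buchholz–Kotecký–Müller ([ABKM19] (6.25)–(6.26))

In the renormalisation step `T_k` of [ABKM19] the contribution of a `k`-polymer `X` is
attributed to the `(k+1)`-polymer `π(X)`: for a connected polymer that is NOT small (more than
`2^d` blocks) `π(X) = X̄` (the `(k+1)`-closure); for a SMALL connected polymer `π(X)` is a single
`(k+1)`-block `B'` meeting `X`, chosen so that `π` is covariant under the translations of
`(L^{k+1}ℤ)^d` (the source picks the block whose centre has the lexicographically first preimage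
in the universal cover); `π(∅) = ∅`; and for a general polymer `π(X) = ⋃_{Y ∈ 𝓒(X)} π(Y)` over the
connected components ((6.26)).

Here the covariant choice on small polymers is made by ORBIT REPRESENTATIVES: `(L^{k+1}ℤ)^d` acts
freely on the small connected `k`-polymers when `2^d L^k ≤ L^{k+1}`
(`TorusPolymer.eq_zero_of_translate_eq`), so choosing one polymer per orbit
(`Classical.epsilon`), one `(k+1)`-block meeting it, and transporting the choice along the orbit
is well defined and covariant — any such choice has every property the source uses ((6.27)–(6.28),
Lemma 6.4; the lexicographic rule is one of them).

* `OrbitRel s' X Y` (`Y = X + a`, `a ∈ (s'ℤ)^d`), `orbitRep`, `orbitShift` (`X = orbitRep X + orbitShift X`);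
* `piSmall s' X = B'_{p + a}` — the chosen `(k+1)`-block through the transported base point;
  `piConn s s' X` — `piSmall` if `|𝓑_k(X)| ≤ 2^d`, else `closure s' X`;
  **`reblock s s' X = ⋃_{Y ∈ 𝓒(X)} piConn s s' Y`** — the map `π`;
* `reblock_empty`, `reblock_eq_empty_iff`; `isPolymer_reblock` (`π(X) ∈ 𝓟_{k+1}`);
  `reblock_of_isConn_of_card_le` (small connected: `π(X) = B'_x` for some `x ∈ X`, one block
  meeting `X`), `reblock_of_isConn_of_lt_card` (large connected: `π(X) = X̄`),
  `reblock_eq_biUnion_components` ((6.26)), `reblock_subset_closure` (`π(X) ⊆ X̄`, hence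
  `π(X) ⊆ W` for every `(k+1)`-polymer `W ⊇ X`);
* **`reblock_translate`** — translation covariance `π(X + c) = π(X) + c` for `c ∈ (s'ℤ)^d`
  (`M = s'·t'`, `s' = L·s`... only `s ∣ s'`, `2^d s ≤ s'`, `s, s', t'` odd are used).

Everything is proved; no named fact.  Connectedness/components are the tree's
`LongRangePhi4.Polymer.IsConn` / `components` (`ℓ^∞`-adjacency); smallness is
`|𝓑_k(X)| ≤ 2^d` (`TorusPolymer.blocks`).  Not here: (6.28) `X* ⊆ π(X)*` and the counting of
small polymers attributed to a block (they involve the small-set radii of the weights and belong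
with Lemma 6.4 / Lemma 9.2).

## References
* S. Adams, S. Buchholz, R. Kotecký, S. Müller, *Cauchy–Born rule from microscopic models with
  non-convex potentials*, arXiv:1910.13564, Ch. 6.3, (6.25)–(6.26) and the paragraph between them
  [AdamsBuchholzKoteckyMuller2019].
-/

noncomputable section

namespace Literature.MathematicalPhysics.StatisticalMechanics.TorusPolymer

open scoped BigOperators Classical
open Finset
open Literature.Barriers.CriticalPhenomena.LongRangePhi4.Polymer
  (AdjInf ConnIn IsConn comp components mem_comp comp_subset mem_comp_self isConn_comp
    eq_biUnion_components)

variable {d M : ℕ}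

/-! ## Orbits of the coarse translation group on sets -/

/-- `Y` is a translate of `X` by the coarse block lattice `(s'ℤ)^d`.
[cite: AdamsBuchholzKoteckyMuller2019, Ch. 6.3 (translation invariance of π)] -/
def OrbitRel (s' : ℕ) (X Y : Finset (Fin d → ZMod M)) : Prop :=
  ∃ a : Fin d → ZMod M, IsLatticeVec s' a ∧ Y = translate a X

/-- Reflexivity. [cite: AdamsBuchholzKoteckyMuller2019, Ch. 6.3] -/
theorem orbitRel_refl (s' : ℕ) (X : Finset (Fin d → ZMod M)) : OrbitRel s' X X :=
  ⟨0, isLatticeVec_zero s', (translate_zero X).symm⟩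

/-- Symmetry. [cite: AdamsBuchholzKoteckyMuller2019, Ch. 6.3] -/
theorem OrbitRel.symm {s' : ℕ} {X Y : Finset (Fin d → ZMod M)} (h : OrbitRel s' X Y) : OrbitRel s' Y X := by
  obtain ⟨a, ha, rfl⟩ := h
  exact ⟨-a, ha.neg, by rw [translate_translate, add_neg_cancel, translate_zero]⟩

/-- Transitivity. [cite: AdamsBuchholzKoteckyMuller2019, Ch. 6.3] -/
theorem OrbitRel.trans {s' : ℕ} {X Y Z : Finset (Fin d → ZMod M)} (h : OrbitRel s' X Y)
    (h' : OrbitRel s' Y Z) : OrbitRel s' X Z := by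
  obtain ⟨a, ha, rfl⟩ := h
  obtain ⟨b, hb, rfl⟩ := h'
  exact ⟨a + b, ha.add hb, by rw [translate_translate]⟩

/-- A representative of the orbit of `X` (the same for all members of the orbit).
[cite: AdamsBuchholzKoteckyMuller2019, Ch. 6.3 (choice of B(X) via the universal cover)] -/
def orbitRep (s' : ℕ) (X : Finset (Fin d → ZMod M)) : Finset (Fin d → ZMod M) :=
  Classical.epsilon fun Y => OrbitRel s' Y X

/-- `X` is a translate of its orbit representative. [cite: AdamsBuchholzKoteckyMuller2019, Ch. 6.3] -/
theorem orbitRel_orbitRep (s' : ℕ) (X : Finset (Fin d → ZMod M)) : OrbitRel s' (orbitRep s' X) X :=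
  Classical.epsilon_spec (p := fun Y => OrbitRel s' Y X) ⟨X, orbitRel_refl s' X⟩

/-- Members of one orbit have the same representative. [cite: AdamsBuchholzKoteckyMuller2019, Ch. 6.3] -/
theorem orbitRep_eq_of_orbitRel {s' : ℕ} {X X' : Finset (Fin d → ZMod M)} (h : OrbitRel s' X X') :
    orbitRep s' X = orbitRep s' X' := by
  unfold orbitRep
  congr 1
  funext Y
  exact propext ⟨fun hY => hY.trans h, fun hY => hY.trans h.symm⟩

/-- The lattice vector carrying the representative to `X`: `X = orbitRep X + orbitShift X`.
[cite: AdamsBuchholzKoteckyMuller2019, Ch. 6.3] -/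
def orbitShift (s' : ℕ) (X : Finset (Fin d → ZMod M)) : Fin d → ZMod M :=
  Classical.choose (orbitRel_orbitRep s' X)

/-- Specification of `orbitShift`. [cite: AdamsBuchholzKoteckyMuller2019, Ch. 6.3] -/
theorem orbitShift_spec (s' : ℕ) (X : Finset (Fin d → ZMod M)) :
    IsLatticeVec s' (orbitShift s' X) ∧ X = translate (orbitShift s' X) (orbitRep s' X) :=
  Classical.choose_spec (orbitRel_orbitRep s' X)

/-- A base point of a set (any point of it; `0` for the empty set).
[cite: AdamsBuchholzKoteckyMuller2019, Ch. 6.3] -/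
def basePt (Y : Finset (Fin d → ZMod M)) : Fin d → ZMod M :=
  if h : Y.Nonempty then h.choose else 0

/-- The base point of a non-empty set belongs to it. [cite: AdamsBuchholzKoteckyMuller2019, Ch. 6.3] -/
theorem basePt_mem {Y : Finset (Fin d → ZMod M)} (h : Y.Nonempty) : basePt Y ∈ Y := by
  rw [basePt, dif_pos h]; exact h.choose_spec

/-! ## The map `π` -/

variable [NeZero M]

/-- `π` on a small connected polymer: the `(k+1)`-block through the transported base point of the
orbit representative (a single block meeting `X`, covariantly chosen).
[cite: AdamsBuchholzKoteckyMuller2019, Ch. 6.3 (6.25)] -/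
def piSmall (s' : ℕ) (X : Finset (Fin d → ZMod M)) : Finset (Fin d → ZMod M) :=
  blockOf s' (basePt (orbitRep s' X) + orbitShift s' X)

/-- `π` on a connected polymer ((6.25)): the chosen block if `X` is small (`|𝓑_k(X)| ≤ 2^d`), the
closure `X̄` otherwise. [cite: AdamsBuchholzKoteckyMuller2019, Ch. 6.3 (6.25)] -/
def piConn (s s' : ℕ) (X : Finset (Fin d → ZMod M)) : Finset (Fin d → ZMod M) :=
  if (blocks s X).card ≤ 2 ^ d then piSmall s' X else closure s' X

/-- **The reblocking map `π : 𝓟_k → 𝓟_{k+1}`** ((6.26)): `π(X) = ⋃_{Y ∈ 𝓒(X)} π(Y)` over the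
connected components, with `π` on connected polymers as in (6.25).  Block sides `s = L^k`,
`s' = L^{k+1}`. [cite: AdamsBuchholzKoteckyMuller2019, Ch. 6.3 (6.26)] -/
def reblock (s s' : ℕ) (X : Finset (Fin d → ZMod M)) : Finset (Fin d → ZMod M) :=
  (components X).biUnion (piConn s s')

/-- `π(∅) = ∅`. [cite: AdamsBuchholzKoteckyMuller2019, Ch. 6.3 (6.25)] -/
@[simp] theorem reblock_empty (s s' : ℕ) : reblock s s' (∅ : Finset (Fin d → ZMod M)) = ∅ := by
  simp [reblock, components]

omit [NeZero M] in
/-- The chosen block meets `X`: `p + a ∈ X` for the transported base point (non-empty `X`).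
[cite: AdamsBuchholzKoteckyMuller2019, Ch. 6.3 (6.25)] -/
theorem basePt_add_orbitShift_mem {s' : ℕ} {X : Finset (Fin d → ZMod M)} (hX : X.Nonempty) :
    basePt (orbitRep s' X) + orbitShift s' X ∈ X := by
  have h := (orbitShift_spec s' X).2
  have hne : (orbitRep s' X).Nonempty := by
    rw [h, translate] at hX
    exact (Finset.image_nonempty.1 hX)
  have hmem : basePt (orbitRep s' X) + orbitShift s' X ∈ translate (orbitShift s' X) (orbitRep s' X) :=
    add_mem_translate_iff.2 (basePt_mem hne)
  rwa [← h] at hmem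

/-- `piConn` of a non-empty set is non-empty. [cite: AdamsBuchholzKoteckyMuller2019, Ch. 6.3] -/
theorem piConn_nonempty (s s' : ℕ) {X : Finset (Fin d → ZMod M)} (hX : X.Nonempty) :
    (piConn s s' X).Nonempty := by
  unfold piConn
  split_ifs
  · exact ⟨_, mem_blockOf_self s' _⟩
  · obtain ⟨x, hx⟩ := hX; exact ⟨x, subset_closure s' X hx⟩

/-- `π(X) = ∅ ↔ X = ∅`. [cite: AdamsBuchholzKoteckyMuller2019, Ch. 6.3 (6.25)] -/
theorem reblock_eq_empty_iff (s s' : ℕ) (X : Finset (Fin d → ZMod M)) : reblock s s' X = ∅ ↔ X = ∅ := by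
  constructor
  · intro h
    by_contra hne
    obtain ⟨x, hx⟩ := Finset.nonempty_iff_ne_empty.2 hne
    have hC : comp X x ∈ components X := mem_image.2 ⟨x, hx, rfl⟩
    obtain ⟨y, hy⟩ := piConn_nonempty s s' (X := comp X x) ⟨x, mem_comp_self hx⟩
    have : y ∈ reblock s s' X := mem_biUnion.2 ⟨comp X x, hC, hy⟩
    rw [h] at this
    exact absurd this (Finset.notMem_empty y)
  · rintro rfl; exact reblock_empty s s'

/-- `closure` is monotone. [cite: AdamsKoteckyMuller2016, Ch. 4] -/
theorem closure_mono (s' : ℕ) {X Y : Finset (Fin d → ZMod M)} (h : X ⊆ Y) : closure s' X ⊆ closure s' Y := by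
  intro y hy
  obtain ⟨x, hx, hxy⟩ := mem_closure.1 hy
  exact mem_closure.2 ⟨x, h hx, hxy⟩

/-- A `(k+1)`-block through a point of `X` lies in `X̄`. [cite: AdamsKoteckyMuller2016, Ch. 4] -/
theorem blockOf_subset_closure {s' : ℕ} {X : Finset (Fin d → ZMod M)} {x : Fin d → ZMod M} (hx : x ∈ X) :
    blockOf s' x ⊆ closure s' X :=
  fun _ hy => mem_closure.2 ⟨x, hx, mem_blockOf.1 hy⟩

/-- `piConn X ⊆ X̄` for non-empty `X`. [cite: AdamsBuchholzKoteckyMuller2019, Ch. 6.3 (6.25)] -/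
theorem piConn_subset_closure (s s' : ℕ) {X : Finset (Fin d → ZMod M)} (hX : X.Nonempty) :
    piConn s s' X ⊆ closure s' X := by
  unfold piConn
  split_ifs
  · exact blockOf_subset_closure (basePt_add_orbitShift_mem hX)
  · exact Subset.rfl

omit [NeZero M] in
/-- Members of `𝓒(X)` are non-empty subsets of `X`. [cite: AdamsBuchholzKoteckyMuller2019, Ch. 6.2] -/
theorem nonempty_of_mem_components {X Y : Finset (Fin d → ZMod M)} (hY : Y ∈ components X) :
    Y.Nonempty ∧ Y ⊆ X := by
  obtain ⟨x, hx, rfl⟩ := mem_image.1 hY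
  exact ⟨⟨x, mem_comp_self hx⟩, comp_subset X x⟩

/-- **`π(X) ⊆ X̄`**; hence `π(X) ⊆ W` for every `(k+1)`-polymer `W ⊇ X`.
[cite: AdamsBuchholzKoteckyMuller2019, Ch. 6.3 (6.25)–(6.26)] -/
theorem reblock_subset_closure (s s' : ℕ) (X : Finset (Fin d → ZMod M)) :
    reblock s s' X ⊆ closure s' X := by
  intro y hy
  obtain ⟨Y, hY, hyY⟩ := mem_biUnion.1 hy
  obtain ⟨hne, hYX⟩ := nonempty_of_mem_components hY
  exact closure_mono s' hYX (piConn_subset_closure s s' hne hyY)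

/-- `π(X) ⊆ W` for every `(k+1)`-polymer `W ⊇ X`. [cite: AdamsBuchholzKoteckyMuller2019, Ch. 6.3] -/
theorem reblock_subset_of_isPolymer (s : ℕ) {s' : ℕ} {X W : Finset (Fin d → ZMod M)} (hXW : X ⊆ W)
    (hW : IsPolymer s' W) : reblock s s' X ⊆ W :=
  (reblock_subset_closure s s' X).trans (closure_subset_of_isPolymer hXW hW)

/-- `piConn X` is a `(k+1)`-polymer. [cite: AdamsBuchholzKoteckyMuller2019, Ch. 6.3 (6.25)] -/
theorem isPolymer_piConn (s s' : ℕ) (X : Finset (Fin d → ZMod M)) : IsPolymer s' (piConn s s' X) := by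
  unfold piConn
  split_ifs
  · exact isPolymer_blockOf s' _
  · exact isPolymer_closure s' X

/-- **`π(X) ∈ 𝓟_{k+1}`.** [cite: AdamsBuchholzKoteckyMuller2019, Ch. 6.3 (6.25)–(6.26)] -/
theorem isPolymer_reblock (s s' : ℕ) (X : Finset (Fin d → ZMod M)) : IsPolymer s' (reblock s s' X) := by
  intro y hy
  obtain ⟨Y, hY, hyY⟩ := mem_biUnion.1 hy
  exact (isPolymer_piConn s s' Y y hyY).trans (subset_biUnion_of_mem (piConn s s') hY)

/-- For a connected set `π(X) = piConn X`. [cite: AdamsBuchholzKoteckyMuller2019, Ch. 6.3 (6.25)] -/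
theorem reblock_of_isConn (s s' : ℕ) {X : Finset (Fin d → ZMod M)} (hX : IsConn X) :
    reblock s s' X = piConn s s' X := by
  rw [reblock, hX.components_eq, singleton_biUnion]

/-- **Small connected polymers go to a single `(k+1)`-block meeting them**: if `X` is connected
with `|𝓑_k(X)| ≤ 2^d` then `π(X) = B'_x` for some `x ∈ X`.
[cite: AdamsBuchholzKoteckyMuller2019, Ch. 6.3 (6.25)] -/
theorem reblock_of_isConn_of_card_le (s s' : ℕ) {X : Finset (Fin d → ZMod M)} (hX : IsConn X)
    (hsmall : (blocks s X).card ≤ 2 ^ d) : ∃ x ∈ X, reblock s s' X = blockOf s' x := by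
  refine ⟨basePt (orbitRep s' X) + orbitShift s' X, basePt_add_orbitShift_mem hX.1, ?_⟩
  rw [reblock_of_isConn s s' hX, piConn, if_pos hsmall, piSmall]

/-- **Large connected polymers go to their closure**: if `X` is connected with `|𝓑_k(X)| > 2^d`
then `π(X) = X̄`. [cite: AdamsBuchholzKoteckyMuller2019, Ch. 6.3 (6.25)] -/
theorem reblock_of_isConn_of_lt_card (s s' : ℕ) {X : Finset (Fin d → ZMod M)} (hX : IsConn X)
    (hlarge : 2 ^ d < (blocks s X).card) : reblock s s' X = closure s' X := by
  rw [reblock_of_isConn s s' hX, piConn, if_neg (not_le.2 hlarge)]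

/-- **(6.26): `π(X) = ⋃_{Y ∈ 𝓒(X)} π(Y)`.** [cite: AdamsBuchholzKoteckyMuller2019, Ch. 6.3 (6.26)] -/
theorem reblock_eq_biUnion_components (s s' : ℕ) (X : Finset (Fin d → ZMod M)) :
    reblock s s' X = (components X).biUnion (reblock s s') := by
  rw [reblock]
  refine Finset.biUnion_congr rfl fun Y hY => ?_
  obtain ⟨x, hx, rfl⟩ := mem_image.1 hY
  exact (reblock_of_isConn s s' (isConn_comp hx)).symm

/-! ## Translation covariance -/

omit [NeZero M] in
/-- Translates are in the same orbit. [cite: AdamsBuchholzKoteckyMuller2019, Ch. 6.3] -/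
theorem orbitRel_translate {s' : ℕ} {c : Fin d → ZMod M} (hc : IsLatticeVec s' c)
    (X : Finset (Fin d → ZMod M)) : OrbitRel s' X (translate c X) :=
  ⟨c, hc, rfl⟩

omit [NeZero M] in
/-- Bookkeeping: `M = s'·t'` with `s ∣ s'` is `M = s·t` with `t` odd when `s', t'` are odd.
[folklore] -/
private theorem exists_fine_factor {s s' t' : ℕ} (hMst : M = s' * t') (hs' : Odd s') (ht' : Odd t')
    (hss : s ∣ s') : ∃ t, M = s * t ∧ Odd t := by
  obtain ⟨q, rfl⟩ := hss
  exact ⟨q * t', by rw [hMst, mul_assoc], (Nat.Odd.of_mul_right hs').mul ht'⟩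

/-- **The shift of a translate**: `orbitShift (X + c) = orbitShift X + c` when `(s'ℤ)^d` acts
freely on the orbit of `X` — here for connected `X` meeting at most `m` blocks of side `s`,
`m s ≤ s'` (`M = s'·t'`, `s ∣ s'`, `s, s', t'` odd). [cite: AdamsBuchholzKoteckyMuller2019, Ch. 6.3] -/
theorem orbitShift_translate {s s' t' m : ℕ} (hMst : M = s' * t') (hs : Odd s) (hs' : Odd s')
    (ht' : Odd t') (hss : s ∣ s') (hms : m * s ≤ s') {X : Finset (Fin d → ZMod M)} (hX : IsConn X)
    (hm : (blocks s X).card ≤ m) {c : Fin d → ZMod M} (hc : IsLatticeVec s' c) :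
    orbitShift s' (translate c X) = orbitShift s' X + c := by
  obtain ⟨t, hMst', hqt⟩ := exists_fine_factor hMst hs' ht' hss
  set Y := orbitRep s' X with hY
  obtain ⟨ha, hXa⟩ := orbitShift_spec s' X
  obtain ⟨ha', hXa'⟩ := orbitShift_spec s' (translate c X)
  set a := orbitShift s' X
  set a' := orbitShift s' (translate c X)
  have hrep : orbitRep s' (translate c X) = Y := (orbitRep_eq_of_orbitRel (orbitRel_translate hc X)).symm
  rw [hrep] at hXa'
  -- `Y + a' = Y + (a + c)`, so `a' − (a + c)` fixes `Y`
  have h1 : translate a' Y = translate (a + c) Y := by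
    rw [← hXa', ← translate_translate, ← hXa]
  have h2 : translate (a' - (a + c)) Y = Y := by
    have := congrArg (translate (-(a + c))) h1
    rwa [translate_translate, translate_translate, add_neg_cancel, translate_zero, ← sub_eq_add_neg] at this
  -- `Y` is connected with few blocks (a translate of `X`)
  have hYX : Y = translate (-a) X := by
    rw [hXa, translate_translate, add_neg_cancel, translate_zero]
  have hYconn : IsConn Y := by rw [hYX]; exact isConn_translate hX (-a)
  have hYm : (blocks s Y).card ≤ m := by
    rw [hYX, card_blocks_translate hMst' hs hqt (ha.neg.of_dvd hss)]; exact hm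
  have hlat : IsLatticeVec s' (a' - (a + c)) := by
    rw [sub_eq_add_neg]; exact ha'.add (ha.add hc).neg
  have h3 := eq_zero_of_translate_eq hs hMst hms hYconn hYm hlat h2
  exact sub_eq_zero.1 h3

/-- `piSmall (X + c) = piSmall X + c` under the freeness hypotheses.
[cite: AdamsBuchholzKoteckyMuller2019, Ch. 6.3] -/
theorem piSmall_translate {s s' t' m : ℕ} (hMst : M = s' * t') (hs : Odd s) (hs' : Odd s')
    (ht' : Odd t') (hss : s ∣ s') (hms : m * s ≤ s') {X : Finset (Fin d → ZMod M)} (hX : IsConn X)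
    (hm : (blocks s X).card ≤ m) {c : Fin d → ZMod M} (hc : IsLatticeVec s' c) :
    piSmall s' (translate c X) = translate c (piSmall s' X) := by
  rw [piSmall, piSmall, orbitShift_translate hMst hs hs' ht' hss hms hX hm hc,
    orbitRep_eq_of_orbitRel (orbitRel_translate hc X) |>.symm, ← add_assoc,
    blockOf_add hMst hs' ht' hc]

/-- `piConn (X + c) = piConn X + c` for connected `X` (`2^d s ≤ s'`).
[cite: AdamsBuchholzKoteckyMuller2019, Ch. 6.3] -/
theorem piConn_translate {s s' t' : ℕ} (hMst : M = s' * t') (hs : Odd s) (hs' : Odd s')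
    (ht' : Odd t') (hss : s ∣ s') (hL : 2 ^ d * s ≤ s') {X : Finset (Fin d → ZMod M)} (hX : IsConn X)
    {c : Fin d → ZMod M} (hc : IsLatticeVec s' c) :
    piConn s s' (translate c X) = translate c (piConn s s' X) := by
  obtain ⟨t, hMst', hqt⟩ := exists_fine_factor hMst hs' ht' hss
  have hcard : (blocks s (translate c X)).card = (blocks s X).card :=
    card_blocks_translate hMst' hs hqt (hc.of_dvd hss) X
  unfold piConn
  rw [hcard]
  split_ifs with h
  · exact piSmall_translate hMst hs hs' ht' hss hL hX h hc
  · exact closure_translate hMst hs' ht' hc X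

/-- **Translation covariance of `π`**: `π(X + c) = π(X) + c` for `c ∈ (L^{k+1}ℤ)^d`
(`M = L^{k+1}·t'`, `L ≥ 2^d`, everything odd).
[cite: AdamsBuchholzKoteckyMuller2019, Ch. 6.3 (π is translation invariant)] -/
theorem reblock_translate {s s' t' : ℕ} (hMst : M = s' * t') (hs : Odd s) (hs' : Odd s')
    (ht' : Odd t') (hss : s ∣ s') (hL : 2 ^ d * s ≤ s') (X : Finset (Fin d → ZMod M))
    {c : Fin d → ZMod M} (hc : IsLatticeVec s' c) :
    reblock s s' (translate c X) = translate c (reblock s s' X) := by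
  rw [reblock, reblock, components_translate, Finset.image_biUnion, translate_biUnion]
  refine Finset.biUnion_congr rfl fun Y hY => ?_
  obtain ⟨x, hx, rfl⟩ := mem_image.1 hY
  exact piConn_translate hMst hs hs' ht' hss hL (isConn_comp hx) hc

end Literature.MathematicalPhysics.StatisticalMechanics.TorusPolymer

end
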